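import Summits.QuantumFields.YangMills.Theorems.ColdStartUniversalityLatticeLangevinDynkinFlat
import Summits.QuantumFields.YangMills.Theorems.ColdStartUniversalityLatticeLangevinTaylorData
import HarnessLib

/-!
# Route `ColdStartUniversality`, rung `stub_fixedCutoffMixing` of K_A1 (stmt-QuantumFields-24809):
# Dynkin's formula in expectation for `C³` test functions with compact support

Helper file (seat `ym-line-csu-p1`, g6): the Dynkin / Itô formula in conditional expectation for a
vector Itô process driven by a flat Brownian motion (`dynkin_expectation_flat`), with the Taylor data
supplied by `taylorData_of_contDiff` — i.e. for every `f : (ι → ℝ) → ℝ` of class `C³` with compact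
support (`dynkin_expectation_flat_of_contDiff`):

  `E[Z (f(X_t) - f(X_s))] = E[Z ∫_{(s,t]} (∑ᵢ ∂ᵢf(X_r) bⁱ_r + ½ ∑ᵢⱼ ∂ⱼ∂ᵢf(X_r) ∑_n σ^{i,n}_r σ^{j,n}_r) dr]`.

No definition, no sorry, standard axioms.  RECORD-rung plumbing (R3); the Yang–Mills mass gap is
NOT proved.
-/

set_option autoImplicit false

noncomputable section

namespace Summit.QuantumFields.YangMills.Theorems.ColdStartUniversality

open MeasureTheory ProbabilityTheory Filter Finset
open scoped NNReal ENNReal Topology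
open Literature.Probability.Process Literature.MathematicalPhysics.QuantumFieldTheory

section Flat

variable {Ω : Type*} {mΩ : MeasurableSpace Ω} {P : Measure Ω} [IsProbabilityMeasure P] {d L : ℕ}
  [NeZero L] {κ : Type} [Fintype κ] {W : ℝ≥0 → Ω → (Edge d L × κ → ℝ)} {ι : Type} [Fintype ι]
  [DecidableEq ι]
  {X : ℝ≥0 → Ω → (ι → ℝ)} {b : ι → ℝ≥0 → Ω → ℝ}
  {σ J : ι → Edge d L × κ → ℝ≥0 → Ω → ℝ} {M : ℝ}
  {f : (ι → ℝ) → ℝ} {s t : ℝ≥0} {Z : Ω → ℝ} {C : ℝ}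

/-- **Dynkin's formula in (conditional) expectation for `C³` test functions with compact support**
(flat noise, joint filtration, bounded progressive coefficients, jointly measurable adapted `X`).
[folklore] -/
theorem dynkin_expectation_flat_of_contDiff (hW : IsFlatBrownian W P)
    (hb : ∀ i, IsStronglyProgressive hW.natFiltration (b i))
    (hσ : ∀ i n, IsStronglyProgressive hW.natFiltration (σ i n))
    (hbM : ∀ i r ω, |b i r ω| ≤ M) (hσM : ∀ i n r ω, |σ i n r ω| ≤ M)
    (hJ : ∀ i n, IsItoIntegral (σ i n) (fun r ω => W r ω n) (J i n) hW.natFiltration P)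
    (hXm : ∀ i, Measurable fun p : Ω × ℝ ↦ X p.2.toNNReal p.1 i)
    (hXa : ∀ i t, StronglyMeasurable[hW.natFiltration t] (fun ω ↦ X t ω i))
    (hXeq : ∀ i, ∀ᵐ ω ∂P, ∀ t, X t ω i = X 0 ω i + (∫ r in (0 : ℝ)..t, b i r.toNNReal ω) + ∑ n, J i n t ω)
    (hf : ContDiff ℝ 3 f) (hfc : HasCompactSupport f)
    (hst : s ≤ t) (hZ : StronglyMeasurable[hW.natFiltration s] Z) (hC : ∀ ω, |Z ω| ≤ C) :
    ∫ ω, Z ω * (f (X t ω) - f (X s ω)) ∂P =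
      ∫ ω, Z ω * (∫ r in Set.Ioc (s : ℝ) t,
        (∑ i, fderiv ℝ f (X r.toNNReal ω) (Pi.single i 1) * b i r.toNNReal ω +
        (1 / 2) * ∑ i, ∑ j, fderiv ℝ (fun z ↦ fderiv ℝ f z (Pi.single i 1)) (X r.toNNReal ω) (Pi.single j 1) *
          ∑ n, σ i n r.toNNReal ω * σ j n r.toNNReal ω)) ∂P := by
  obtain ⟨Cf, -, hfB, hgc, hhc, hgB, hhB, hgL, hhL, hT⟩ := taylorData_of_contDiff hf hfc
  exact dynkin_expectation_flat (g := fun i y ↦ fderiv ℝ f y (Pi.single i 1))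
    (h := fun i j y ↦ fderiv ℝ (fun z ↦ fderiv ℝ f z (Pi.single i 1)) y (Pi.single j 1))
    hW hb hσ hbM hσM hJ hXm hXa hXeq hf.continuous hgc hhc hfB hgB hhB hgL hhL hT hst hZ hC

end Flat

end Summit.QuantumFields.YangMills.Theorems.ColdStartUniversality

end
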